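import Mathlib.NumberTheory.SmoothNumbers
import Literature.NumberTheory.LFunctions.PolynomialRootMoebiusDirichlet
import HarnessLib

/-!
# The friable Möbius–root sum `G_g(X, N) = ∑_{d ≤ X, P⁺(d) < N} μ(d)ρ_g(d)/d`: Buchstab's identity

Topic `Literature/NumberTheory/Sieve`. Everything here is PROVED (no definitions, no named facts).

For `g ∈ ℤ[X]` write `ρ_g(d) = #{n mod d : g(n) ≡ 0}` (`polyRootCountMod ![g] d`,
multiplicative) and `a(d) = μ(d)ρ_g(d)`. The **friable (truncated) Möbius–root sum**

`G_g(X, N) = ∑_{d ≤ X, d N-friable} a(d)/d`   (`d ∈ Nat.smoothNumbersUpTo X N`: every prime factor of `d` is `< N`)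

is the main-term density of the level-`X` Type-I part of the Legendre sieve along the values of
`g` sifted by the primes `< N`. This file proves the combinatorial identities:

* `friableSum_eq_sum_Icc_of_lt` — `G_g(X, N) = M_g(X) := ∑_{d ≤ X} a(d)/d` for `N > X`;
* `friableSum_succ_of_prime` / `friableSum_succ_of_not_prime` — removing one prime:
  `G_g(X, p + 1) = G_g(X, p) − (ρ_g(p)/p) G_g(⌊X/p⌋, p)` (`μ(pm) = −μ(m)` for `p ∤ m`, `= 0` for `p ∣ m`);
* `friableSum_eq_sub_sum_primes` — **Buchstab's identity** (telescoped):
  `G_g(X, N₁) = G_g(X, N₀) − ∑_{N₀ ≤ p < N₁} (ρ_g(p)/p) G_g(⌊X/p⌋, p)`;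
* `friableSum_eq_sum_Icc_add_sum_primes` — the base form
  `G_g(X, N) = M_g(X) + ∑_{N ≤ p ≤ X} (ρ_g(p)/p) G_g(⌊X/p⌋, p)`;
* `friableSum_div_eq_sum_Icc_of_sq_lt` — `G_g(⌊X/p⌋, p) = M_g(⌊X/p⌋)` when `p² > X`.

## References

* N. G. de Bruijn, *On the number of uncancelled elements in the sieve of Eratosthenes*,
  Indag. Math. 12 (1950), 247–256 (Buchstab iteration). [deBruijn1950]
* G. Tenenbaum, *Introduction to analytic and probabilistic number theory*, Ch. III.6.

## Mathlib

Used: `Nat.smoothNumbersUpTo` / `Nat.mem_smoothNumbersUpTo`, `Nat.mem_smoothNumbers'`,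
`Nat.smoothNumbers_succ`, `Nat.smoothNumbers_mono`, `Nat.mem_smoothNumbers_of_lt`,
`Nat.mul_mem_smoothNumbers`, `Nat.mem_smoothNumbers_of_dvd`, `Nat.Prime.smoothNumbers_coprime`,
`ArithmeticFunction.isMultiplicative_moebius`, `ArithmeticFunction.moebius_apply_prime`,
`ArithmeticFunction.moebius_eq_zero_of_not_squarefree`, `Finset.sum_nbij'`,
`Finset.sum_filter_add_sum_filter_not`, `Nat.le_induction`.
-/

open Finset Real Polynomial ArithmeticFunction
open scoped ArithmeticFunction.Moebius

noncomputable section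

namespace Literature.NumberTheory.Sieve

namespace FriableMoebiusRoot

/-- `w_g(d) = a(d)/d = μ(d)ρ_g(d)/d` as a real number (local notation producing the applied
term, no definition). -/
local notation "w[" g "](" d ")" =>
  (ArithmeticFunction.moebius d : ℝ) * (polyRootCountMod ![g] d : ℝ) / d

variable (g : ℤ[X])

/-! ### Trivial ranges -/

/-- `smoothNumbersUpTo X N ⊆ Icc 1 X`. [folklore] -/
theorem smoothNumbersUpTo_subset_Icc (X N : ℕ) : Nat.smoothNumbersUpTo X N ⊆ Icc 1 X := by
  intro n hn
  rw [Nat.mem_smoothNumbersUpTo] at hn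
  exact Finset.mem_Icc.2 ⟨Nat.one_le_iff_ne_zero.2 hn.2.1, hn.1⟩

/-- For `N > X` every `1 ≤ d ≤ X` is `N`-friable: `G_g(X, N) = M_g(X)`. [folklore] -/
theorem friableSum_eq_sum_Icc_of_lt {X N : ℕ} (h : X < N) :
    ∑ d ∈ Nat.smoothNumbersUpTo X N, w[g](d) = ∑ d ∈ Icc 1 X, w[g](d) := by
  refine Finset.sum_congr ?_ fun _ _ => rfl
  refine Subset.antisymm (smoothNumbersUpTo_subset_Icc X N) fun n hn => ?_
  rw [Finset.mem_Icc] at hn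
  exact Nat.mem_smoothNumbersUpTo.2 ⟨hn.2, Nat.mem_smoothNumbers_of_lt hn.1 (hn.2.trans_lt h)⟩

/-! ### Removing one prime -/

/-- `a(pm) = −ρ_g(p) a(m)` for a prime `p ∤ m`, and `a(pm) = 0` for `p ∣ m`; in the form
`w(pm) = −(ρ_g(p)/p) w(m)` resp. `0`. [folklore] -/
theorem w_prime_mul {p m : ℕ} (hp : p.Prime) (hpm : ¬ p ∣ m) :
    w[g](p * m) = -((polyRootCountMod ![g] p : ℝ) / p) * w[g](m) := by
  have hc : p.Coprime m := hp.coprime_iff_not_dvd.2 hpm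
  rw [ArithmeticFunction.isMultiplicative_moebius.map_mul_of_coprime hc,
    ArithmeticFunction.moebius_apply_prime hp, polyRootCountMod_mul_of_coprime g hc]
  push_cast
  ring

/-- `w(pm) = 0` when `p ∣ m` (`pm` is not squarefree). [folklore] -/
theorem w_prime_mul_of_dvd {p m : ℕ} (hp : p.Prime) (hpm : p ∣ m) : w[g](p * m) = 0 := by
  have h : ¬ Squarefree (p * m) := fun hsq =>
    hp.coprime_iff_not_dvd.1 (Nat.squarefree_mul_iff.1 hsq).1 hpm
  rw [ArithmeticFunction.moebius_eq_zero_of_not_squarefree h]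
  simp

/-- A `(p+1)`-friable number not divisible by `p` is `p`-friable. [folklore] -/
private theorem mem_smoothNumbers_of_succ_of_not_dvd {p m : ℕ} (hpm : ¬ p ∣ m)
    (hm : m ∈ Nat.smoothNumbers (p + 1)) : m ∈ Nat.smoothNumbers p := by
  rw [Nat.mem_smoothNumbers'] at hm ⊢
  intro q hq hqm
  rcases (Nat.lt_succ_iff_lt_or_eq.1 (hm q hq hqm)) with h | rfl
  · exact h
  · exact absurd hqm hpm

/-- The `(p+1)`-friable `d ≤ X` not divisible by the prime `p` are exactly the `p`-friable
`d ≤ X`. [folklore] -/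
private theorem filter_not_dvd_smoothNumbersUpTo_succ {p : ℕ} (hp : p.Prime) (X : ℕ) :
    (Nat.smoothNumbersUpTo X (p + 1)).filter (fun d => ¬ p ∣ d) = Nat.smoothNumbersUpTo X p := by
  ext d
  simp only [Finset.mem_filter, Nat.mem_smoothNumbersUpTo]
  constructor
  · rintro ⟨⟨hd, hsm⟩, hnd⟩
    exact ⟨hd, mem_smoothNumbers_of_succ_of_not_dvd hnd hsm⟩
  · rintro ⟨hd, hsm⟩
    exact ⟨⟨hd, Nat.smoothNumbers_mono p.le_succ hsm⟩,
      hp.coprime_iff_not_dvd.1 (hp.smoothNumbers_coprime hsm)⟩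

/-- The part of `G_g(X, p + 1)` over the multiples of the prime `p` equals
`−(ρ_g(p)/p) G_g(⌊X/p⌋, p)` (substitute `d = pm`; the `m` with `p ∣ m` contribute `0`).
[folklore] -/
private theorem sum_filter_dvd_smoothNumbersUpTo_succ {p : ℕ} (hp : p.Prime) (X : ℕ) :
    ∑ d ∈ (Nat.smoothNumbersUpTo X (p + 1)).filter (fun d => p ∣ d), w[g](d) =
      -((polyRootCountMod ![g] p : ℝ) / p) * ∑ m ∈ Nat.smoothNumbersUpTo (X / p) p, w[g](m) := by
  calc ∑ d ∈ (Nat.smoothNumbersUpTo X (p + 1)).filter (fun d => p ∣ d), w[g](d)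
      = ∑ m ∈ Nat.smoothNumbersUpTo (X / p) (p + 1), w[g](p * m) := by
        symm
        refine Finset.sum_nbij' (p * ·) (· / p) ?_ ?_ ?_ ?_ ?_
        · intro m hm
          rw [Nat.mem_smoothNumbersUpTo] at hm
          rw [Finset.mem_filter, Nat.mem_smoothNumbersUpTo]
          exact ⟨⟨mul_comm m p ▸ (Nat.le_div_iff_mul_le hp.pos).1 hm.1,
            Nat.mul_mem_smoothNumbers (Nat.mem_smoothNumbers_of_lt hp.pos p.lt_succ_self) hm.2⟩,
            dvd_mul_right p m⟩
        · intro d hd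
          rw [Finset.mem_filter, Nat.mem_smoothNumbersUpTo] at hd
          rw [Nat.mem_smoothNumbersUpTo]
          exact ⟨Nat.div_le_div_right hd.1.1,
            Nat.mem_smoothNumbers_of_dvd hd.1.2 (Nat.div_dvd_of_dvd hd.2)⟩
        · intro m _
          exact Nat.mul_div_cancel_left m hp.pos
        · intro d hd
          exact Nat.mul_div_cancel' (Finset.mem_filter.1 hd).2
        · intro m _
          simp only [Nat.cast_mul]
    _ = ∑ m ∈ Nat.smoothNumbersUpTo (X / p) p, w[g](p * m) := by
        symm
        refine Finset.sum_subset (fun m hm => ?_) (fun m hm hm' => ?_)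
        · rw [Nat.mem_smoothNumbersUpTo] at hm ⊢
          exact ⟨hm.1, Nat.smoothNumbers_mono p.le_succ hm.2⟩
        · have hpm : p ∣ m := by
            by_contra hnd
            rw [Nat.mem_smoothNumbersUpTo] at hm hm'
            exact hm' ⟨hm.1, mem_smoothNumbers_of_succ_of_not_dvd hnd hm.2⟩
          exact w_prime_mul_of_dvd g hp hpm
    _ = -((polyRootCountMod ![g] p : ℝ) / p) * ∑ m ∈ Nat.smoothNumbersUpTo (X / p) p, w[g](m) := by
        rw [Finset.mul_sum]
        refine Finset.sum_congr rfl fun m hm => ?_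
        rw [Nat.mem_smoothNumbersUpTo] at hm
        exact w_prime_mul g hp (hp.coprime_iff_not_dvd.1 (hp.smoothNumbers_coprime hm.2))

/-- **One prime at a time**: for a prime `p`,
`G_g(X, p + 1) = G_g(X, p) − (ρ_g(p)/p) · G_g(⌊X/p⌋, p)`. [folklore] -/
theorem friableSum_succ_of_prime {p : ℕ} (hp : p.Prime) (X : ℕ) :
    ∑ d ∈ Nat.smoothNumbersUpTo X (p + 1), w[g](d) =
      ∑ d ∈ Nat.smoothNumbersUpTo X p, w[g](d) -
        (polyRootCountMod ![g] p : ℝ) / p * ∑ d ∈ Nat.smoothNumbersUpTo (X / p) p, w[g](d) := by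
  rw [← Finset.sum_filter_add_sum_filter_not _ (fun d => p ∣ d),
    filter_not_dvd_smoothNumbersUpTo_succ hp X, sum_filter_dvd_smoothNumbersUpTo_succ g hp X]
  ring

/-- For `N` not prime, `G_g(X, N + 1) = G_g(X, N)`. [folklore] -/
theorem friableSum_succ_of_not_prime {N : ℕ} (hN : ¬ N.Prime) (X : ℕ) :
    ∑ d ∈ Nat.smoothNumbersUpTo X (N + 1), w[g](d) = ∑ d ∈ Nat.smoothNumbersUpTo X N, w[g](d) := by
  refine Finset.sum_congr ?_ fun _ _ => rfl
  ext d
  simp only [Nat.mem_smoothNumbersUpTo, Nat.smoothNumbers_succ hN]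

/-! ### Buchstab's identity -/

/-- **Buchstab's identity for the friable Möbius–root sum**: for `N₀ ≤ N₁`,
`G_g(X, N₁) = G_g(X, N₀) − ∑_{N₀ ≤ p < N₁, p prime} (ρ_g(p)/p) G_g(⌊X/p⌋, p)`.
[cite: deBruijn1950, Buchstab iteration] -/
theorem friableSum_eq_sub_sum_primes {N₀ N₁ : ℕ} (h : N₀ ≤ N₁) (X : ℕ) :
    ∑ d ∈ Nat.smoothNumbersUpTo X N₁, w[g](d) =
      ∑ d ∈ Nat.smoothNumbersUpTo X N₀, w[g](d) -
        ∑ p ∈ (Ico N₀ N₁).filter Nat.Prime,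
          (polyRootCountMod ![g] p : ℝ) / p * ∑ d ∈ Nat.smoothNumbersUpTo (X / p) p, w[g](d) := by
  induction N₁, h using Nat.le_induction with
  | base => simp
  | succ N₁ hN ih =>
    have hnot : N₁ ∉ (Ico N₀ N₁).filter Nat.Prime := by simp
    rw [Nat.Ico_succ_right_eq_insert_Ico hN, Finset.filter_insert]
    by_cases hP : N₁.Prime
    · rw [if_pos hP, Finset.sum_insert hnot, friableSum_succ_of_prime g hP, ih]
      ring
    · rw [if_neg hP, friableSum_succ_of_not_prime g hP, ih]

/-- **The base form**: for `N ≤ X + 1`,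
`G_g(X, N) = M_g(X) + ∑_{N ≤ p ≤ X, p prime} (ρ_g(p)/p) G_g(⌊X/p⌋, p)`. [folklore] -/
theorem friableSum_eq_sum_Icc_add_sum_primes {X N : ℕ} (hN : N ≤ X + 1) :
    ∑ d ∈ Nat.smoothNumbersUpTo X N, w[g](d) =
      ∑ d ∈ Icc 1 X, w[g](d) +
        ∑ p ∈ (Ico N (X + 1)).filter Nat.Prime,
          (polyRootCountMod ![g] p : ℝ) / p * ∑ d ∈ Nat.smoothNumbersUpTo (X / p) p, w[g](d) := by
  have h := friableSum_eq_sub_sum_primes g hN X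
  rw [friableSum_eq_sum_Icc_of_lt g X.lt_succ_self] at h
  linarith

/-- When `p² > X` the inner sum is complete: `G_g(⌊X/p⌋, p) = M_g(⌊X/p⌋)`. [folklore] -/
theorem friableSum_div_eq_sum_Icc_of_sq_lt {X p : ℕ} (hp : 0 < p) (h : X < p * p) :
    ∑ d ∈ Nat.smoothNumbersUpTo (X / p) p, w[g](d) = ∑ d ∈ Icc 1 (X / p), w[g](d) :=
  friableSum_eq_sum_Icc_of_lt g ((Nat.div_lt_iff_lt_mul hp).2 h)

end FriableMoebiusRoot

end Literature.NumberTheory.Sieve
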